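import Summits.QuantumFields.QCD.Theses.NestedDissectionSea

/-!
# Line `Sketch` for the crux `RobustYangMillsRG` (stmt-QuantumFields-14958) — the lever
# `schwarz_flattening` (card `schwarz-flattening`, crux-ideate r1/k1; PROVED there, landed here)

Crux: `Summit.QuantumFields.QCD.Theses.NestedDissectionSea.RobustYangMillsRG` (shared verbatim with
`HeavyThresholdYMBridge`), item stmt-QuantumFields-14958; skeleton `Cruxes/RobustYangMillsRG/Lines/Sketch.lean`
(lead `prover-line-stmt-QuantumFields-14958-0`).  This module lands the line's lever, proved by the
ideator in `Cruxes/RobustYangMillsRG/Sketch_r1_k1.lean` and re-checked by the lead: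

* `ball_subset_smallFieldDomain` — the `r`-ball (sup-Frobenius distance of the `ρ`-link variables)
  around a real `ε`-small configuration lies in the small-field analyticity domain of the polymer;
* `schwarz_flattening` — **Schwarz flattening**: an activity of a quasi-local gauge perturbation `W`
  that is analytic with bound `M X` on the g-uniform small-field domain `smallFieldDomain ρ b r ε X`
  is `2 M_X / r`-Lipschitz in the link variables around every real `ε`-small configuration:
  `|W_X(U′) − W_X(U)| ≤ (2 M_X / r) · dist(ρ∘U′, ρ∘U)` whenever the distance is `< r` (one-variable
  Schwarz lemma, Mathlib `Complex.dist_le_div_mul_dist_of_mapsTo_ball`, on the complex disc through the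
  two configurations).  Consequence used by the line (card, FINDINGS-r1-k1 A2): on typical block fields
  every admissible `O(1)` analytic remainder of the Bałaban format is coupling-relatively sup-small,
  `η_eff ≲ B₀ g²/r²` — the RG-level crux is a D1-level cone problem around the perfect action;
* `schwarz_flattening_of_hasAnalyticNormLE` — the same under `HasAnalyticNormLE ρ (smallFieldDomain ρ b r ε) κ B`
  with the constant `2 B e^{-κ|X|} / r` read off the weighted sum;
* `SchwarzFlattening` / `stub_schwarzFlattening` — the closed statement registered as a stub of the
  skeleton and its proof (by `schwarz_flattening`).

Sources: Bałaban, CMP 119 (1988) p. 259 (ii), p. 261 (2.41)–(2.42) (analyticity domains and bounds);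
the Schwarz lemma.
-/

set_option autoImplicit false

noncomputable section

open MeasureTheory Filter Topology Metric Set
open scoped Matrix.Norms.Frobenius
open Literature.MathematicalPhysics.QuantumLattice Literature.MathematicalPhysics.QuantumFieldTheory

namespace Summit.QuantumFields.QCD.Cruxes.RobustYangMillsRG.Sketch

variable {d L N : ℕ} [NeZero L] {G : Type*} [Group G] {b : ℕ}

/-- The `r`-ball around a real `ε`-small configuration lies in the small-field domain of `X`. -/
theorem ball_subset_smallFieldDomain (ρ : G →* Matrix (Fin N) (Fin N) ℂ) {r ε : ℝ}
    {X : Finset (Site d L)} {U : GaugeConfig d L G}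
    (hU : ∀ p ∈ polymerPlaquettes b X,
      (N : ℝ) - (ρ (plaquetteHolonomy U p.1 p.2.1.1 p.2.1.2)).trace.re ≤ ε) :
    ball (complexify ρ U) r ⊆ smallFieldDomain ρ b r ε X := by
  unfold smallFieldDomain
  exact Set.subset_biUnion_of_mem (u := fun V : GaugeConfig d L G => ball (complexify ρ V) r) hU

variable [MeasurableSpace G]

/-- **Schwarz flattening.** If the activities of `W` are analytic on the g-uniform small-field
domains with bounds `M`, then around every real `ε`-small configuration `U` each activity is
`2 M_X / r`-Lipschitz in the link variables: for `U'` with `dist (ρ ∘ U') (ρ ∘ U) < r`,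
`|W_X(U') − W_X(U)| ≤ (2 M_X / r) · dist (ρ ∘ U') (ρ ∘ U)`.  (Schwarz lemma for the bounded
holomorphic function `z ↦ F_X(c + (z/δ)(c' − c))` on the disc `|z| < r`.) -/
theorem schwarz_flattening (ρ : G →* Matrix (Fin N) (Fin N) ℂ)
    (W : QuasiLocalGaugePerturbation d L G b)
    {r ε : ℝ} (hr : 0 < r) {M : Finset (Site d L) → ℝ}
    (hW : W.IsAnalyticOn ρ (smallFieldDomain ρ b r ε) M)
    {X : Finset (Site d L)} (hX : X ∈ polymers (d := d) (L := L) b) {U U' : GaugeConfig d L G}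
    (hU : ∀ p ∈ polymerPlaquettes b X,
      (N : ℝ) - (ρ (plaquetteHolonomy U p.1 p.2.1.1 p.2.1.2)).trace.re ≤ ε)
    (hδ : dist (complexify ρ U') (complexify ρ U) < r) :
    |W.act X U' - W.act X U| ≤ 2 * M X / r * dist (complexify ρ U') (complexify ρ U) := by
  obtain ⟨F, hFd, hFW, hFM⟩ := hW X hX
  -- notation: `c = ρ ∘ U`, `c' = ρ ∘ U'`, `δ = dist c' c`
  have hball : ball (complexify ρ U) r ⊆ smallFieldDomain ρ b r ε X :=
    ball_subset_smallFieldDomain ρ hU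
  have hcD : complexify ρ U ∈ smallFieldDomain ρ b r ε X := hball (mem_ball_self hr)
  have hc'D : complexify ρ U' ∈ smallFieldDomain ρ b r ε X := hball (mem_ball.2 hδ)
  -- the real activities are the restrictions of `F`
  have hWU : (W.act X U : ℂ) = F (complexify ρ U) := (hFW U hcD).symm
  have hWU' : (W.act X U' : ℂ) = F (complexify ρ U') := (hFW U' hc'D).symm
  have hdiff : |W.act X U' - W.act X U| = dist (F (complexify ρ U')) (F (complexify ρ U)) := by
    rw [dist_eq_norm, ← hWU, ← hWU', ← Complex.ofReal_sub, Complex.norm_real, Real.norm_eq_abs]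
  rw [hdiff]
  have hM0 : 0 ≤ M X := (norm_nonneg _).trans (hFM _ hcD)
  rcases eq_or_lt_of_le (dist_nonneg : 0 ≤ dist (complexify ρ U') (complexify ρ U)) with hδ0 | hδpos
  · -- degenerate case `c' = c`
    have hcc : complexify ρ U' = complexify ρ U := dist_eq_zero.1 hδ0.symm
    rw [hcc, dist_self, dist_self, mul_zero]
  · -- the complex disc through `c` and `c'`: `g z = c + (z/δ) (c' - c)`
    have hne : ((dist (complexify ρ U') (complexify ρ U) : ℝ) : ℂ) ≠ 0 := by
      exact_mod_cast hδpos.ne'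
    let g : ℂ → ComplexGaugeConfig d L N := fun z =>
      complexify ρ U + (z / (dist (complexify ρ U') (complexify ρ U) : ℂ)) •
        (complexify ρ U' - complexify ρ U)
    have hg0 : g 0 = complexify ρ U := by
      show complexify ρ U + ((0 : ℂ) / _) • _ = _
      rw [zero_div, zero_smul, add_zero]
    have hgδ : g (dist (complexify ρ U') (complexify ρ U) : ℂ) = complexify ρ U' := by
      show complexify ρ U + (_ / _) • _ = _
      rw [div_self hne, one_smul, add_sub_cancel]
    have hgdist : ∀ z : ℂ, dist (g z) (complexify ρ U) = ‖z‖ := by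
      intro z
      have hcc : ‖complexify ρ U' - complexify ρ U‖ = dist (complexify ρ U') (complexify ρ U) := by
        rw [← dist_eq_norm]
      show dist (complexify ρ U + (z / (dist (complexify ρ U') (complexify ρ U) : ℂ)) •
        (complexify ρ U' - complexify ρ U)) (complexify ρ U) = ‖z‖
      rw [dist_eq_norm, add_sub_cancel_left, norm_smul, norm_div, Complex.norm_real, Real.norm_eq_abs,
        abs_of_pos hδpos, hcc, div_mul_cancel₀ _ hδpos.ne']
    have hgmaps : MapsTo g (ball (0 : ℂ) r) (smallFieldDomain ρ b r ε X) := by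
      intro z hz
      apply hball
      rw [mem_ball, hgdist z]
      simpa using hz
    have hgdiffble : Differentiable ℂ g :=
      ((differentiable_id.div_const _).smul_const _).const_add _
    have hfd : DifferentiableOn ℂ (F ∘ g) (ball (0 : ℂ) r) :=
      hFd.comp hgdiffble.differentiableOn hgmaps
    have hf0 : (F ∘ g) 0 = F (complexify ρ U) := by
      show F (g 0) = _; rw [hg0]
    have hfδ : (F ∘ g) (dist (complexify ρ U') (complexify ρ U) : ℂ) = F (complexify ρ U') := by
      show F (g _) = _; rw [hgδ]
    -- Schwarz lemma with target radius `2 M X`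
    have hmaps : MapsTo (F ∘ g) (ball (0 : ℂ) r) (closedBall ((F ∘ g) 0) (2 * M X)) := by
      intro z hz
      rw [mem_closedBall, hf0]
      have h1 : ‖F (g z)‖ ≤ M X := hFM _ (hgmaps hz)
      have h2 : ‖F (complexify ρ U)‖ ≤ M X := hFM _ hcD
      calc dist ((F ∘ g) z) (F (complexify ρ U)) = ‖F (g z) - F (complexify ρ U)‖ := by
            rw [dist_eq_norm]; rfl
        _ ≤ ‖F (g z)‖ + ‖F (complexify ρ U)‖ := norm_sub_le _ _
        _ ≤ M X + M X := add_le_add h1 h2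
        _ = 2 * M X := by ring
    have hzδ : (dist (complexify ρ U') (complexify ρ U) : ℂ) ∈ ball (0 : ℂ) r := by
      rw [mem_ball, dist_zero_right, Complex.norm_real, Real.norm_eq_abs, abs_of_pos hδpos]
      exact hδ
    have key := Complex.dist_le_div_mul_dist_of_mapsTo_ball hfd hmaps hzδ
    rw [hfδ, hf0, dist_zero_right, Complex.norm_real, Real.norm_eq_abs, abs_of_pos hδpos] at key
    exact key

/-- **Schwarz flattening, norm form**: under an analytic weighted-norm bound
`HasAnalyticNormLE ρ (smallFieldDomain ρ b r ε) κ B` every activity through a block corner is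
`2 B e^{-κ|X|} / r`-Lipschitz around real `ε`-small configurations (the bound `M X ≤ B e^{-κ|X|}`
for `X ∋ y` read off the weighted sum, all `M X' ≥ 0` because every small-field domain contains the
identity configuration when `0 ≤ ε`). -/
theorem schwarz_flattening_of_hasAnalyticNormLE (ρ : G →* Matrix (Fin N) (Fin N) ℂ)
    (W : QuasiLocalGaugePerturbation d L G b)
    {r ε κ B : ℝ} (hr : 0 < r) (hε : 0 ≤ ε)
    (hW : W.HasAnalyticNormLE ρ (smallFieldDomain ρ b r ε) κ B)
    {X : Finset (Site d L)} {y : Site d L} (hy : y ∈ blockCorners (d := d) (L := L) b)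
    (hX : X ∈ polymersThrough (d := d) (L := L) b y) {U U' : GaugeConfig d L G}
    (hU : ∀ p ∈ polymerPlaquettes b X,
      (N : ℝ) - (ρ (plaquetteHolonomy U p.1 p.2.1.1 p.2.1.2)).trace.re ≤ ε)
    (hδ : dist (complexify ρ U') (complexify ρ U) < r) :
    |W.act X U' - W.act X U| ≤
      2 * (B * Real.exp (-(κ * X.card))) / r * dist (complexify ρ U') (complexify ρ U) := by
  obtain ⟨M, hA, hM⟩ := hW
  have hXp : X ∈ polymers (d := d) (L := L) b := (mem_polymersThrough_iff.1 hX).1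
  -- every bound is nonnegative: the identity configuration is `ε`-small and lies in each domain
  have hM0 : ∀ X' ∈ polymers (d := d) (L := L) b, 0 ≤ M X' := by
    intro X' hX'
    obtain ⟨F, -, -, hFM⟩ := hA X' hX'
    have h1 : complexify ρ (1 : GaugeConfig d L G) ∈ smallFieldDomain ρ b r ε X' := by
      refine complexify_mem_smallFieldDomain ρ hr fun p _ => ?_
      have hp : plaquetteHolonomy (1 : GaugeConfig d L G) p.1 p.2.1.1 p.2.1.2 = 1 := by
        simp [plaquetteHolonomy]
      rw [hp, map_one, Matrix.trace_one, Fintype.card_fin]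
      simpa using hε
    exact (norm_nonneg _).trans (hFM _ h1)
  -- `M X e^{κ|X|} ≤ Σ_{X' ∋ y} M X' e^{κ|X'|} ≤ B`
  have hMX : M X ≤ B * Real.exp (-(κ * X.card)) := by
    have hsum := hM y hy
    have hle : M X * Real.exp (κ * X.card) ≤
        ∑ X' ∈ polymersThrough b y, M X' * Real.exp (κ * X'.card) :=
      Finset.single_le_sum (f := fun X' => M X' * Real.exp (κ * X'.card))
        (fun X' hX' => mul_nonneg (hM0 X' (mem_polymersThrough_iff.1 hX').1) (Real.exp_pos _).le) hX
    have h := hle.trans hsum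
    rw [Real.exp_neg, ← div_eq_mul_inv, le_div_iff₀ (Real.exp_pos _)]
    exact h
  calc |W.act X U' - W.act X U| ≤ 2 * M X / r * dist (complexify ρ U') (complexify ρ U) :=
        schwarz_flattening ρ W hr hA hXp hU hδ
    _ ≤ 2 * (B * Real.exp (-(κ * X.card))) / r * dist (complexify ρ U') (complexify ρ U) := by
        gcongr

/-! ### The registered stub `stub_schwarzFlattening` (closed statement, verbatim from the skeleton) -/

/-- **Schwarz flattening** (the line's lever, PROVED by crux-ideate r1/k1; closed statement): an
activity of `W` analytic with bound `M X` on the g-uniform small-field domain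
`smallFieldDomain ρ b r ε X` is `2 M_X / r`-Lipschitz in the `ρ`-link variables (sup-Frobenius
distance) around every real `ε`-small configuration, within distance `r`. -/
def SchwarzFlattening : Prop :=
  ∀ (d L N : ℕ) [NeZero L] (G : Type) [Group G] [MeasurableSpace G] (b : ℕ)
    (ρ : G →* Matrix (Fin N) (Fin N) ℂ) (W : QuasiLocalGaugePerturbation d L G b) (r ε : ℝ), 0 < r →
    ∀ (M : Finset (Site d L) → ℝ), W.IsAnalyticOn ρ (smallFieldDomain ρ b r ε) M →
    ∀ X ∈ polymers (d := d) (L := L) b, ∀ (U U' : GaugeConfig d L G),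
      (∀ p ∈ polymerPlaquettes b X,
        (N : ℝ) - (ρ (plaquetteHolonomy U p.1 p.2.1.1 p.2.1.2)).trace.re ≤ ε) →
      dist (complexify ρ U') (complexify ρ U) < r →
        |W.act X U' - W.act X U| ≤ 2 * M X / r * dist (complexify ρ U') (complexify ρ U)

/-- **stub_schwarzFlattening** — the registered stub of line `Sketch`, closed by `schwarz_flattening`. -/
theorem stub_schwarzFlattening : SchwarzFlattening :=
  fun _d _L _N _ _G _ _ _b ρ W _r _ε hr _M hW _X hX _U _U' hU hδ =>
    schwarz_flattening ρ W hr hW hX hU hδ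

end Summit.QuantumFields.QCD.Cruxes.RobustYangMillsRG.Sketch

end
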